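import Summits.PneNP.PneNP.Theorems.ReslinSizeFromWidthPCDegreeGOPFamily
import Literature.Computability.MetaComplexity.GraphOrderingResolutionUpper
import Literature.Computability.MetaComplexity.ResLinProofs
import HarnessLib

/-!
# PneNP / ReslinSizeFromWidth — GOP(G) on the in-tree expanders: EASY for resolution size, HARD for Res(⊕) rank, tree-like Res(⊕) and PC degree

Helper file for the INPUT side of crux `ResLinSizeFromWidth` (stmt-PneNP-18932): the CONTRAST
cell for the graph ordering principle.  Combining

* the in-tree bounded-degree vertex-expander family (`exists_boundedDegree_vertexExpander`,
  `ReslinSizeFromWidthPCDegreeGOPFamily.lean`: on every `Fin n`, degrees `≤ 12`,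
  `(⌊n/72⌋, 1)`-vertex expansion) with the unconditional GOP rail (Galesi–Lauria Thm 1, proved;
  PC rail; quadratic / tree-like / space laws), and
* Stålmarck's short resolution refutation of `GOP(G)` for EVERY graph
  (`GOPRes.exists_isResRefutation_glGOP`, `GraphOrderingResolutionUpper.lean`: `≤ 12 n³` lines;
  Res(⊕) simulates resolution line by line, `IsResRefutation.exists_isResLinRefutation`),

gives, for every `n ≥ 3744`, a 12-CNF `GOP(G_n)` on `Θ(n²)` variables which has resolution AND
dag-like Res(⊕) refutations with `≤ 12 n³` lines, while every Res(⊕) refutation has a line of rank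
`≥ d`, every TREE-LIKE Res(⊕) refutation has `≥ 2^(d-13)` lines and there is no PC refutation of
degree `≤ d` over any field, for all `13 ≤ d ≤ ⌊n/72⌋/4` (`exists_GOP_easy_hard`).  This is
Galesi–Lauria's Theorem 2 in full shape (size–degree trade-off optimality: polynomial size, degree
`Ω(|V|)`), here with resolution size in place of PCR size, and at the same time a
resolution-vs-tree-like-Res(⊕) separation on a bounded-width family with LINEAR Res(⊕) rank (cf.
`orderingCNF_separation` for `Ordering_n`, whose clauses have width `n`).  For the ladder it is a
TIGHTNESS remark: on 12-CNFs with `N = Θ(n²)` variables, Res(⊕) rank `Θ(√N)` is compatible with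
polynomial dag-like Res(⊕) size, so no size-from-rank law can give superpolynomial size from rank
`√N` (the crux asks for rank linear in `N`).

Honest framing: assembly of landed results; constants crude; the expander is existential
(counting).  Not claimed: PCR size (GL10 Lemma 1), regularity of the refutation.

References: N. Galesi, M. Lauria, ACM ToCL 12(1) (2010), §3 p. 8, Thms 1–2; M. L. Bonet,
N. Galesi, Comput. Complexity 10 (2001) (optimality of size–width trade-offs); S. Gryaznov,
S. Ovcharov, A. Riazanov, ACM ToCT 2024, §1 (resolution vs tree-like Res(⊕)).
-/

noncomputable section

namespace Summit.PneNP.PneNP.Theorems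

-- `Summit.PneNP.PneNP` repeats a path component by design (summit = sub-problem); silence the linter.
set_option linter.dupNamespace false

namespace ResLinPC

open Finset Literature.Computability.Complexity Literature.Computability.MetaComplexity
open Summit.PneNP.PneNP.Theorems.PolyCalc

universe u

/-- **GOP(G) on the in-tree expanders is easy for resolution and hard for Res(⊕) rank / tree-like
Res(⊕) / PC degree.**  For every `n ≥ 3744` there is a simple graph `G` on `Fin n` with all
degrees `≤ 12` such that: `GOP(G)` has a resolution refutation AND a dag-like Res(⊕) refutation
with at most `12 n³` lines; for every field `K` and every `d ≤ ⌊n/72⌋/4` there is no PC/K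
refutation of degree `≤ d`; and for every `13 ≤ d ≤ ⌊n/72⌋/4`, every Res(⊕) refutation
(semantic weakening) has a line of rank `≥ d` and every tree-like one has `≥ 2^(d-13)` lines.
[Galesi–Lauria 2010, Thm 2 (shape) with §3 p. 8; Stålmarck 1996; the tree's rail] -/
theorem exists_GOP_easy_hard (n : ℕ) (hn : 3744 ≤ n) :
    ∃ G : SimpleGraph (Fin n), ∃ _ : DecidableRel G.Adj, (∀ v, G.degree v ≤ 12) ∧
      (∃ π : List (ResLine ℕ), IsResRefutation (GOP.glGOP G) π ∧ π.length ≤ 12 * n ^ 3) ∧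
      (∃ π : List ResLinLine, IsResLinRefutation (GOP.glGOP G) π ∧ π.length ≤ 12 * n ^ 3) ∧
      (∀ (K : Type u) [Field K] (d : ℕ), (d : ℝ) ≤ ((n / 72 : ℕ) : ℝ) / 4 →
        ¬ PC.RefutableInDegree (PC.ofCNF K (GOP.glGOP G)) d) ∧
      ∀ d : ℕ, 13 ≤ d → (d : ℝ) ≤ ((n / 72 : ℕ) : ℝ) / 4 →
        ∀ π : List ResLinLine, IsResLinRefutation (GOP.glGOP G) π →
          d ≤ resLinWidth π ∧
          ((∀ i : ℕ, (π.map fun l => l.premises.count i).sum ≤ 1) → 2 ^ (d - 13) ≤ π.length) := by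
  obtain ⟨G, inst, hdeg, hexp⟩ := exists_boundedDegree_vertexExpander n
  refine ⟨G, inst, hdeg, ?_, ?_, ?_, ?_⟩
  · exact GOPRes.exists_isResRefutation_glGOP G (by omega)
  · obtain ⟨π, hπ, hlen⟩ := GOPRes.exists_isResRefutation_glGOP G (show 2 ≤ n by omega)
    obtain ⟨π', hπ', hcl⟩ := hπ.exists_isResLinRefutation
    have hlen' : π'.length = π.length := by simpa using congrArg List.length hcl
    exact ⟨π', hπ', by omega⟩
  · intro K _ d hd
    have hr : 1 ≤ n / 72 := (Nat.le_div_iff_mul_le (by norm_num)).2 (by omega)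
    exact GOP.not_refutableInDegree_glGOP (K := K) hexp one_pos hr (by rw [one_mul]; exact hd)
  · intro d h13 hd π hπ
    have hr : 1 ≤ n / 72 := (Nat.le_div_iff_mul_le (by norm_num)).2 (by omega)
    have hd' : (d : ℝ) ≤ 1 * (n / 72 : ℕ) / 4 := by rw [one_mul]; exact hd
    have hdeg' : ∀ u, G.degree u ≤ d := fun u => (hdeg u).trans (by omega)
    refine ⟨resLinWidth_glGOP' G hr one_pos hexp (by omega) hdeg' hd' hπ, fun htree => ?_⟩
    have h := treeLike_length_glGOP' G hr one_pos hexp (by norm_num) hdeg (by omega) hd' hπ htree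
    rw [Nat.sub_sub] at h
    exact h

end ResLinPC

end Summit.PneNP.PneNP.Theorems
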